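import Summits.QuantumFields.YangMills.Theorems.AllWindowsColdBoxBoxHighLineRestrictionSetCum4Slots
import Summits.QuantumFields.YangMills.Theorems.AllWindowsColdBoxBoxHighLineConnectedFourPointCubicMuSet
import Summits.QuantumFields.YangMills.Theorems.AllWindowsColdBoxBoxHighLineTiltUMomentsPrelims
import Summits.QuantumFields.YangMills.Theorems.AllWindowsColdBoxBoxHighLinePlaqCostMomentsOnD
import Summits.QuantumFields.YangMills.Theorems.AllWindowsColdBoxBoxHighLinePlaqCostSizesOnD
import Summits.QuantumFields.YangMills.Theorems.AllWindowsColdBoxBoxHighLineTiltUParitySizes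
import Summits.QuantumFields.YangMills.Theorems.AllWindowsColdBoxBoxHighLineGhostTaylor
import Summits.QuantumFields.YangMills.Theorems.AllWindowsColdBoxBoxHighLineTripleBond
import Summits.QuantumFields.YangMills.Theorems.AllWindowsColdBoxBoxHighLineCubicVertexPoly
import Summits.QuantumFields.YangMills.Theorems.AllWindowsColdBoxBoxHighLineK4PrimeRowR2Prelims

/-!
# K4′(b) ROWS R3 + R4 of LEAD g78's term table (`ym-idea-1/g78-K4PRIME-TERM-TABLE.md`): the odd small remainder `N = Gᵒ − R₅` of the tilt exponent
# inside `κ₄,₀^{μ_{D′}}` — `κ₄(c_x, c_y; N)` (R3) and `CROSS(c_x, c_y; P, N)` (R4) — by the restricted-Gaussian Hölder bound of fcl-p3 g27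
# (planner ym-idea-2 g18 00:46:21Z «rows taken by name»; LINE-20 U5 ⟨stmt-QuantumFields-24336⟩ `stub_landauThirdOrder`, hypothesis hK4 of ✓`landauThirdOrder_of_sizes`;
# U5 prep, helper-grade; U5 is UNSTAFFED)

Width seat `ym-line-sfw-p2-w2` (g33).  Letters EXACTLY as R1 ✓p753305 (`EdgeChartGaussian.abs_tiltCum4_muSet_cubicPair_le`) and w5 g24's R2: an arbitrary
Taylor tensor `Tc` with `|Tc p i j k| ≤ B`, `P a := β·Σ_{p ∈ plaquettesTouching (boxEdges 4 (2H+1))} tripleForm (Tc p) (plaqVar H p … a)`, a GENERIC odd small remainder `N` (measurable, `sup_{D′}|N| ≤ ν`; of record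
`N = (tiltU − tiltU∘neg)/2 ∓ P = Gᵒ − R₅` with `ν = C·H⁶L^m s³ + ρ` from §0/§4), `μ_{D′} :=
(volume.restrict D′).withDensity (ofReal ∘ gaussWeight β H)` for a measurable `D′ ⊆ smallField H s` with the τ-binders `E₀[1 − 1_{D′}] ≤ τ ≤ 1/2`:

* §0 ★`GaussNormalForm.abs_tiltU_odd_add_cubicVertex_le` — the «`Gᵒ` re-export» LEAD asked for: `∃ C c₀ m, ∀ H ≥ 1, ∀ β s, 0 ≤ s → s·H² ≤ c₀ →
  ∀ a ∈ smallField H s, |(tiltU a − tiltU(−a))/2 + cubicVertex a| ≤ C·H⁶·(1+log H)^m·s³` (the `hUo` step of fcl-p3 g26's ✓`gaussAvg_sfInd_tiltU_odd_sq_le_of`, now over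
  ✓`ghostTaylor` by name; `quadVal M_H` is even ✓`quadVal_neg`, the other even parts cancel ✓`tiltU_sub_tiltU_neg`);
* §1 plumbing: `gaussAvg_indicator_mul_pow_four_le_of_bdd` (`E₀[1_D·(F − 0)⁴] ≤ S⁴` when `|F| ≤ S` on `D`), `gaussAvg_indicator_mul_pow_four_le_of_polyCert`
  (`E₀[1_D·(P − 0)⁴] ≤ 3^{2d}·A²` when `P` has degree `≤ d` and `E₀[P²] ≤ A`, Bonami–Nelson ✓`gaussAvg_pow_even_le_of_polyCert_of_le`), `sqrt_sqrt_bound`;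
* §2 ★★`abs_tiltCum4_muSet_rowR3_le` (R3, `N` GENERIC per LEAD's letters of record 00:58:56Z (c): measurable, `sup_{D′}|N| ≤ ν`):
  `|Tilt.tiltCum4 μ_{D′} N 0 c_x c_y| ≤ 128·(116s²)²·ν²` — `κ₄,₀(X,Y;N) ≡ CROSS_N(X,Y;N,N)` (w5 g24's ✓`tiltCum4_zero_eq_cross`) and fcl-p3's
  ✓`GaussRestrict.abs_cross_muSet_zero_le_gaussAvg` with `E₀[1_{D′}c⁴] ≤ (116s²)⁴` (✓`TiltSup.abs_chartPlaqCost_le`), `E₀[1_{D′}N⁴] ≤ ν⁴`;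
* §4 `exists_tripleTensor_cubicVertex` — ONE Taylor tensor `Tc` of record with `|cubicVertex − P| ≤ C·β·H⁴·s⁵` on `smallField H s` (the `ρ` of R3/R4,
  the `Tc, B` of R1/R2; ✓7a as in ✓`exists_cubicVertexPoly`);
* §3 ★★`abs_cross_muSet_rowR4_le` (R4, `N` generic): `|CROSS_P(c_x, c_y; P, N)| ≤ 128·(116s²)²·(√(√(729·A_T²))·ν)`, `A_T = C_T·B²·H⁴·(1+log H)³/β`
  (✓`tripleBond_gaussAvg_le`; `E₀[1_{D′}P⁴] ≤ 3⁶·A_T²` Bonami–Nelson), CROSS in the letter of ✓`GaussRestrict.tiltCum4_muSet_zero_add_third` with `E := Tilt.tiltExp μ_{D′} P 0`,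
  `P` FIRST (LEAD's (b)).  For the `N` of record `(tiltU − tiltU∘neg)/2 ∓ P` the supplier of `ν = C·H⁶L^m s³ + ρ` is §0 + §4 (any sign of `Tc`).
LEAD's size column: `s⁴·ν²` and `s⁴·B·H²L^{3/2}β^{−1/2}·ν`; rel rows `20θ + 10κ₃ < 3`, `16θ + 7κ₃ < 2` at `κ₃ = 1/8 − θ/4` (the assembler's ✓`budget_monomial`).

Mathlib + tree only; no definitions; standard axioms.  HONEST LABEL: helper-grade rows of K4′ for the (UNSTAFFED) third-order assembly of the XL stub U5 of a critic-PASSed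
DRAFT line; U5, ⟨24336⟩, ⟨24004⟩ and the seat's own crux ⟨22884⟩ remain OPEN; route AllWindowsColdBox is DRAFT; no crux, rung or summit is proved; **the Yang–Mills mass
gap is NOT proved by this file; no summit is proved by a line.**
-/

set_option autoImplicit false

noncomputable section

open MeasureTheory Set
open Literature.Probability.LatticeModels (Site)
open Literature.MathematicalPhysics.QuantumLattice (plaquettesTouching ZdPlaquette)
open Literature.MathematicalPhysics.QuantumFieldTheory.AxialGauge (boxEdges)

namespace Summit.QuantumFields.YangMills.Theorems.AllWindowsColdBoxBoxHighLine

namespace GaussNormalForm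

open LaplaceSandwich (flatten)

variable {H : ℕ} {β : ℝ}

/-! ## §0 The odd ghost tail `Gᵒ = Uᵒ + V₃` is `O(H⁶(1+log H)^m s³)` on the small field -/

/-- ★ **The odd part of the tilt exponent is the cubic vertex up to the odd ghost tail**: there are `C ≥ 0`, `c₀ > 0`, `m` with, for `H ≥ 1`, `0 ≤ s`,
`s·H² ≤ c₀` and every `a ∈ smallField H s`, `|(tiltU β H a − tiltU β H (−a))/2 + cubicVertex β H a| ≤ C·H⁶·(1+log H)^m·s³`
(✓`tiltU_sub_tiltU_neg`: the odd part is `−V₃ + (g(a) − g(−a))/2`, `g = ghostLogRatio`; ✓`ghostTaylor` with the EVEN `quadVal M_H` ✓`quadVal_neg`). -/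
theorem abs_tiltU_odd_add_cubicVertex_le : ∃ C c₀ : ℝ, ∃ m : ℕ, 0 ≤ C ∧ 0 < c₀ ∧ ∀ H : ℕ, 1 ≤ H → ∀ β s : ℝ, 0 ≤ s → s * (H : ℝ) ^ 2 ≤ c₀ →
    ∀ a ∈ smallField H s, |(tiltU β H a - tiltU β H (-a)) / 2 + cubicVertex β H a| ≤ C * (H : ℝ) ^ 6 * (1 + Real.log H) ^ m * s ^ 3 := by
  obtain ⟨Cg, c₀, mg, hc₀, hG⟩ := ghostTaylor
  refine ⟨max Cg 0, c₀, mg, le_max_right _ _, hc₀, fun H hH β s hs0 hsH a ha => ?_⟩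
  obtain ⟨M, -, hT⟩ := hG H hH
  have ha' : -a ∈ smallField H s := (EdgeChartGaussian.neg_mem_smallField_iff s a).2 ha
  have h1 : |ghostLogRatio H a - quadVal M a| ≤ Cg * (H : ℝ) ^ 6 * (1 + Real.log H) ^ mg * s ^ 3 := hT s a hs0 hsH ha
  have h2 : |ghostLogRatio H (-a) - quadVal M (-a)| ≤ Cg * (H : ℝ) ^ 6 * (1 + Real.log H) ^ mg * s ^ 3 := hT s (-a) hs0 hsH ha'
  rw [TiltSup.quadVal_neg] at h2
  have e : (tiltU β H a - tiltU β H (-a)) / 2 + cubicVertex β H a =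
      ((ghostLogRatio H a - quadVal M a) - (ghostLogRatio H (-a) - quadVal M a)) / 2 := by
    rw [TiltSup.tiltU_sub_tiltU_neg hH]; ring
  rw [e, abs_div, abs_two, div_le_iff₀ (by norm_num : (0:ℝ) < 2)]
  have h0 : 0 ≤ (H : ℝ) ^ 6 * (1 + Real.log H) ^ mg * s ^ 3 := by
    have hH1 : (1 : ℝ) ≤ H := by exact_mod_cast hH
    have : 0 ≤ Real.log (H : ℝ) := Real.log_nonneg hH1
    positivity
  have hCg : Cg * (H : ℝ) ^ 6 * (1 + Real.log H) ^ mg * s ^ 3 ≤ max Cg 0 * (H : ℝ) ^ 6 * (1 + Real.log H) ^ mg * s ^ 3 := by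
    have := mul_le_mul_of_nonneg_right (le_max_left Cg 0) h0
    calc Cg * (H : ℝ) ^ 6 * (1 + Real.log H) ^ mg * s ^ 3 = Cg * ((H : ℝ) ^ 6 * (1 + Real.log H) ^ mg * s ^ 3) := by ring
      _ ≤ max Cg 0 * ((H : ℝ) ^ 6 * (1 + Real.log H) ^ mg * s ^ 3) := this
      _ = _ := by ring
  have := abs_sub (ghostLogRatio H a - quadVal M a) (ghostLogRatio H (-a) - quadVal M a)
  linarith

/-! ## §1 Plumbing: restricted fourth moments and the `√√` arithmetic -/

/-- `E₀[1_D·(F − 0)⁴] ≤ S⁴` for `F` measurable with `|F| ≤ S` on `D` (`β > 0`, `D` measurable). -/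
theorem gaussAvg_indicator_mul_pow_four_le_of_bdd (hβ : 0 < β) {D : Set (LandauFree H → E3)} (hD : MeasurableSet D)
    {F : (LandauFree H → E3) → ℝ} (hFm : Measurable F) {S : ℝ} (hF : ∀ a ∈ D, |F a| ≤ S) :
    gaussAvg β H (fun a => D.indicator (fun _ => (1 : ℝ)) a * (F a - 0) ^ 4) ≤ S ^ 4 := by
  have hpt : ∀ a, D.indicator (fun _ => (1 : ℝ)) a * (F a - 0) ^ 4 ≤ S ^ 4 := by
    intro a
    by_cases ha : a ∈ D
    · rw [indicator_of_mem ha, one_mul, sub_zero]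
      have h := hF a ha
      have h4 := pow_le_pow_left₀ (abs_nonneg _) h 4
      have : F a ^ 4 = |F a| ^ 4 := by rw [← abs_pow, abs_of_nonneg (by positivity)]
      rw [this]; exact h4
    · rw [indicator_of_notMem ha, zero_mul]; positivity
  have habs : ∀ a, |D.indicator (fun _ => (1 : ℝ)) a * (F a - 0) ^ 4| ≤ S ^ 4 := fun a => by
    rw [abs_of_nonneg (mul_nonneg (GaussRestrict.indicator_one_nonneg_le_one D a).1 (by positivity))]; exact hpt a
  have hI := Tilt.integrable_bdd_mul_gaussWeight H hβ ((measurable_const.indicator hD).mul ((hFm.sub measurable_const).pow_const 4)) habs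
  have hC := Tilt.integrable_bdd_mul_gaussWeight H hβ (measurable_const : Measurable fun _ : LandauFree H → E3 => S ^ 4)
    (fun _ => by rw [abs_of_nonneg (by positivity)])
  calc gaussAvg β H (fun a => D.indicator (fun _ => (1 : ℝ)) a * (F a - 0) ^ 4) ≤ gaussAvg β H (fun _ => S ^ 4) :=
        EdgeChartGaussian.gaussAvg_mono H hβ hpt hI hC
    _ = S ^ 4 := EdgeChartGaussian.gaussAvg_const_fun H hβ _

/-- `E₀[1_D·(P − 0)⁴] ≤ 3^{2d}·A²` for a certified polynomial `P` of degree `≤ d` with `E₀[P²] ≤ A` (Bonami–Nelson at `k = 2`, then drop `1_D ≤ 1`). -/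
theorem gaussAvg_indicator_mul_pow_four_le_of_polyCert (hβ : 0 < β) {D : Set (LandauFree H → E3)} (hD : MeasurableSet D)
    {P : (LandauFree H → E3) → ℝ} {d : ℕ}
    (hP : ∃ Q : MvPolynomial (LandauFree H × Fin 3) ℝ, Q.totalDegree ≤ d ∧ ∀ a, P a = MvPolynomial.eval (flatten (LandauFree H) a) Q)
    {A : ℝ} (hA : gaussAvg β H (fun a => P a ^ 2) ≤ A) :
    gaussAvg β H (fun a => D.indicator (fun _ => (1 : ℝ)) a * (P a - 0) ^ 4) ≤ (3 : ℝ) ^ (2 * d) * A ^ 2 := by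
  have hBN := gaussAvg_pow_even_le_of_polyCert_of_le H hβ hP hA 2 (by norm_num)
  have h4 : (fun a => P a ^ (2 * 2)) = fun a => P a ^ 4 := by funext a; norm_num
  rw [h4] at hBN
  have hI4 : Integrable fun a : LandauFree H → E3 => P a ^ 4 * gaussWeight β H a :=
    EdgeChartGaussian.integrable_polyCert_mul_gaussWeight H hβ (EdgeChartGaussian.polyCert_pow hP 4)
  have hI : Integrable fun a : LandauFree H → E3 => (D.indicator (fun _ => (1 : ℝ)) a * (P a - 0) ^ 4) * gaussWeight β H a := by
    have e : (fun a : LandauFree H → E3 => (D.indicator (fun _ => (1 : ℝ)) a * (P a - 0) ^ 4) * gaussWeight β H a) =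
        fun a => D.indicator (fun _ => (1 : ℝ)) a * (P a ^ 4 * gaussWeight β H a) := by funext a; ring
    rw [e]
    exact hI4.bdd_mul (measurable_const.indicator hD).aestronglyMeasurable
      (Filter.Eventually.of_forall fun a => by
        rw [Real.norm_eq_abs]; obtain ⟨h0, h1⟩ := GaussRestrict.indicator_one_nonneg_le_one D a; rw [abs_of_nonneg h0]; exact h1)
  have hle : ∀ a, D.indicator (fun _ => (1 : ℝ)) a * (P a - 0) ^ 4 ≤ P a ^ 4 := fun a => by
    obtain ⟨h0, h1⟩ := GaussRestrict.indicator_one_nonneg_le_one D a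
    rw [sub_zero]
    have : 0 ≤ P a ^ 4 := by positivity
    nlinarith
  calc gaussAvg β H (fun a => D.indicator (fun _ => (1 : ℝ)) a * (P a - 0) ^ 4) ≤ gaussAvg β H (fun a => P a ^ 4) :=
        EdgeChartGaussian.gaussAvg_mono H hβ hle hI hI4
    _ ≤ (2 * (2 : ℕ) - 1 : ℝ) ^ (2 * d) * A ^ 2 := hBN
    _ = (3 : ℝ) ^ (2 * d) * A ^ 2 := by norm_num

/-- The `√√` arithmetic of fcl-p3's CROSS bound: if `0 ≤ A₁ ≤ a⁴`, `0 ≤ A₂ ≤ a⁴`, `A₃ ≤ u`, `0 ≤ A₄ ≤ v⁴` then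
`4·√(√(32A₁)·√(32A₂))·√(√(32A₃)·√(32A₄)) ≤ 4·(√32·a²)·√(√(32·u)·(√32·v²))`. -/
theorem sqrt_sqrt_bound {A₁ A₂ A₃ A₄ a u v : ℝ} (h1 : 0 ≤ A₁) (h2 : 0 ≤ A₂) (h4 : 0 ≤ A₄)
    (b1 : A₁ ≤ a ^ 4) (b2 : A₂ ≤ a ^ 4) (b3 : A₃ ≤ u) (b4 : A₄ ≤ v ^ 4) :
    4 * (Real.sqrt (Real.sqrt (32 * A₁) * Real.sqrt (32 * A₂)) * Real.sqrt (Real.sqrt (32 * A₃) * Real.sqrt (32 * A₄))) ≤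
      4 * ((Real.sqrt 32 * a ^ 2) * Real.sqrt (Real.sqrt (32 * u) * (Real.sqrt 32 * v ^ 2))) := by
  have h32 : (0 : ℝ) ≤ Real.sqrt 32 := Real.sqrt_nonneg _
  have hsq32 : Real.sqrt 32 * Real.sqrt 32 = 32 := Real.mul_self_sqrt (by norm_num)
  have s1 : Real.sqrt (32 * A₁) ≤ Real.sqrt 32 * a ^ 2 := by
    rw [Real.sqrt_le_left (by positivity)]; nlinarith [hsq32, sq_nonneg a]
  have s2 : Real.sqrt (32 * A₂) ≤ Real.sqrt 32 * a ^ 2 := by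
    rw [Real.sqrt_le_left (by positivity)]; nlinarith [hsq32, sq_nonneg a]
  have s4 : Real.sqrt (32 * A₄) ≤ Real.sqrt 32 * v ^ 2 := by
    rw [Real.sqrt_le_left (by positivity)]; nlinarith [hsq32, sq_nonneg v]
  have s3 : Real.sqrt (32 * A₃) ≤ Real.sqrt (32 * u) := Real.sqrt_le_sqrt (by linarith)
  have p12 : Real.sqrt (32 * A₁) * Real.sqrt (32 * A₂) ≤ (Real.sqrt 32 * a ^ 2) ^ 2 := by
    rw [sq]; exact mul_le_mul s1 s2 (Real.sqrt_nonneg _) (by positivity)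
  have q12 : Real.sqrt (Real.sqrt (32 * A₁) * Real.sqrt (32 * A₂)) ≤ Real.sqrt 32 * a ^ 2 := by
    rw [Real.sqrt_le_left (by positivity)]; exact p12
  have p34 : Real.sqrt (32 * A₃) * Real.sqrt (32 * A₄) ≤ Real.sqrt (32 * u) * (Real.sqrt 32 * v ^ 2) :=
    mul_le_mul s3 s4 (Real.sqrt_nonneg _) (Real.sqrt_nonneg _)
  have q34 : Real.sqrt (Real.sqrt (32 * A₃) * Real.sqrt (32 * A₄)) ≤ Real.sqrt (Real.sqrt (32 * u) * (Real.sqrt 32 * v ^ 2)) :=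
    Real.sqrt_le_sqrt p34
  have := mul_le_mul q12 q34 (Real.sqrt_nonneg _) (by positivity)
  linarith

/-! ## §2 Row R3: `κ₄(c_x, c_y; N)` for a GENERIC small odd remainder `N` (LEAD's letters of record 00:58:56Z (c): `sup_{D′}|N| ≤ ν`) -/

/-- `√(√(32u)·(√32·v²)) = √32·(√(√u)·v)` for `v ≥ 0`. -/
theorem sqrt_sqrt_mul_eq {u v : ℝ} (hv : 0 ≤ v) :
    Real.sqrt (Real.sqrt (32 * u) * (Real.sqrt 32 * v ^ 2)) = Real.sqrt 32 * (Real.sqrt (Real.sqrt u) * v) := by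
  have hsq32 : Real.sqrt 32 * Real.sqrt 32 = 32 := Real.mul_self_sqrt (by norm_num)
  rw [Real.sqrt_mul (by norm_num : (0:ℝ) ≤ 32)]
  have e : Real.sqrt 32 * Real.sqrt u * (Real.sqrt 32 * v ^ 2) = 32 * (Real.sqrt u * v ^ 2) := by
    calc Real.sqrt 32 * Real.sqrt u * (Real.sqrt 32 * v ^ 2) = (Real.sqrt 32 * Real.sqrt 32) * (Real.sqrt u * v ^ 2) := by ring
      _ = 32 * (Real.sqrt u * v ^ 2) := by rw [hsq32]
  rw [e, Real.sqrt_mul (by norm_num : (0:ℝ) ≤ 32), Real.sqrt_mul (Real.sqrt_nonneg u), Real.sqrt_sq hv]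

/-- ★★ **ROW R3 of LEAD g78's K4′(b) term table** (N generic).  For `β > 0`, `0 ≤ s ≤ 1`, any measurable `D ⊆ smallField H s` with `E₀[1 − 1_D] ≤ τ ≤ 1/2`, any
measurable `N` with `|N| ≤ ν` on `D` (`ν ≥ 0`) and all `x y`: `|κ₄,₀^{μ_D}(c_x, c_y; N, N)| ≤ 128·(116s²)²·ν²` (tilt letter `N`; ✓`tiltCum4_zero_eq_cross` +
fcl-p3's ✓`abs_cross_muSet_zero_le_gaussAvg` with `E₀[1_D c⁴] ≤ (116s²)⁴`, `E₀[1_D N⁴] ≤ ν⁴`).  The `ν` of record for `N = Uᵒ ∓ P` is §0 + the quintic remainder. -/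
theorem abs_tiltCum4_muSet_rowR3_le (hβ : 0 < β) {s : ℝ} (hs0 : 0 ≤ s) (hs1 : s ≤ 1) {D : Set (LandauFree H → E3)} (hDm : MeasurableSet D)
    (hDs : D ⊆ smallField H s) {τ : ℝ} (hτ : gaussAvg β H (fun a => 1 - D.indicator (fun _ => (1 : ℝ)) a) ≤ τ) (hτ2 : τ ≤ 1 / 2)
    {N : (LandauFree H → E3) → ℝ} (mN : Measurable N) {ν : ℝ} (hν : 0 ≤ ν) (bN : ∀ a ∈ D, |N a| ≤ ν) (x y : Site 4) :
    |Tilt.tiltCum4 (((volume : Measure (LandauFree H → E3)).restrict D).withDensity fun a => ENNReal.ofReal (gaussWeight β H a)) N 0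
        (chartPlaqCost H x 1 2) (chartPlaqCost H y 1 2)| ≤ 128 * (116 * s ^ 2) ^ 2 * ν ^ 2 := by
  set μD : Measure (LandauFree H → E3) := ((volume : Measure (LandauFree H → E3)).restrict D).withDensity fun a => ENNReal.ofReal (gaussWeight β H a)
    with hμD
  have hXb : ∀ z : Site 4, ∀ a ∈ D, |chartPlaqCost H z 1 2 a| ≤ 116 * s ^ 2 := fun z a ha => TiltSup.abs_chartPlaqCost_le hs0 hs1 (hDs ha) z 1 2
  set Bc : ℝ := max (116 * s ^ 2) ν with hBc
  have hBc0 : 0 ≤ Bc := le_max_of_le_left (by positivity)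
  have bX : ∀ a ∈ D, |chartPlaqCost H x 1 2 a| ≤ Bc := fun a ha => (hXb x a ha).trans (le_max_left _ _)
  have bY : ∀ a ∈ D, |chartPlaqCost H y 1 2 a| ≤ Bc := fun a ha => (hXb y a ha).trans (le_max_left _ _)
  have bN' : ∀ a ∈ D, |N a| ≤ Bc := fun a ha => (bN a ha).trans (le_max_right _ _)
  have mX := EdgeChartGaussian.measurable_chartPlaqCost H x 1 2
  have mY := EdgeChartGaussian.measurable_chartPlaqCost H y 1 2
  have hc := GaussRestrict.abs_cross_muSet_zero_le_gaussAvg hβ hDm hτ hτ2 hBc0 mX mY mN mN bX bY bN' bN' 0 0 0 0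
  dsimp only at hc
  have A1 := gaussAvg_indicator_mul_pow_four_le_of_bdd hβ hDm mX (hXb x)
  have A2 := gaussAvg_indicator_mul_pow_four_le_of_bdd hβ hDm mY (hXb y)
  have A3 := gaussAvg_indicator_mul_pow_four_le_of_bdd hβ hDm mN bN
  have n0 : ∀ F : (LandauFree H → E3) → ℝ, 0 ≤ gaussAvg β H (fun a => D.indicator (fun _ => (1 : ℝ)) a * (F a - 0) ^ 4) := fun F =>
    EdgeChartGaussian.gaussAvg_nonneg H hβ fun a => mul_nonneg (GaussRestrict.indicator_one_nonneg_le_one D a).1 (by positivity)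
  have hss := sqrt_sqrt_bound (u := ν ^ 4) (n0 _) (n0 _) (n0 _) A1 A2 A3 A3
  have hsq32 : Real.sqrt 32 * Real.sqrt 32 = 32 := Real.mul_self_sqrt (by norm_num)
  have h4 : Real.sqrt (Real.sqrt (ν ^ 4)) = ν := by
    rw [show ν ^ 4 = (ν ^ 2) ^ 2 by ring, Real.sqrt_sq (sq_nonneg ν), Real.sqrt_sq hν]
  rw [sqrt_sqrt_mul_eq hν, h4] at hss
  have hfin : 4 * ((Real.sqrt 32 * (116 * s ^ 2) ^ 2) * (Real.sqrt 32 * (ν * ν))) = 128 * (116 * s ^ 2) ^ 2 * ν ^ 2 := by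
    calc 4 * ((Real.sqrt 32 * (116 * s ^ 2) ^ 2) * (Real.sqrt 32 * (ν * ν))) = 4 * (Real.sqrt 32 * Real.sqrt 32) * (116 * s ^ 2) ^ 2 * ν ^ 2 := by ring
      _ = _ := by rw [hsq32]; ring
  rw [tiltCum4_zero_eq_cross μD N]
  exact hc.trans (hss.trans hfin.le)

/-! ## §3 Row R4: `CROSS_P(c_x, c_y; P, N)` (E in the letter `P`, `P` FIRST — LEAD's letters of record 00:58:56Z (b)) -/

/-- ★★ **ROW R4 of LEAD g78's K4′(b) term table** (N generic).  With `C_T` from ✓`tripleBond_gaussAvg_le`: for `H ≥ 1`, `β > 0`, `0 ≤ s ≤ 1`, any `|Tc| ≤ B`,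
any measurable `D ⊆ smallField H s` with `E₀[1 − 1_D] ≤ τ ≤ 1/2`, any measurable `N` with `|N| ≤ ν` on `D` (`ν ≥ 0`) and all `x y`, in the CROSS letter of
✓`GaussRestrict.tiltCum4_muSet_zero_add_third` with `E := Tilt.tiltExp μ_D P 0`:
`|CROSS_P(c_x, c_y; P, N)| ≤ 128·(116s²)²·(√(√(729·A_T²))·ν)`, `A_T = C_T·B²·H⁴·(1+log H)³/β` (so `√√(729A_T²) = √27·√A_T ≍ B·H²L^{3/2}β^{−1/2}`). -/
theorem abs_cross_muSet_rowR4_le : ∃ CT : ℝ, ∀ H : ℕ, 1 ≤ H → ∀ β : ℝ, 0 < β → ∀ s : ℝ, 0 ≤ s → s ≤ 1 →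
    ∀ B : ℝ, ∀ Tc : ZdPlaquette 4 → Fin 4 → Fin 4 → Fin 4 → ℝ, (∀ p i j k, |Tc p i j k| ≤ B) →
    ∀ D : Set (LandauFree H → E3), MeasurableSet D → D ⊆ smallField H s →
    ∀ τ : ℝ, gaussAvg β H (fun a => 1 - D.indicator (fun _ => (1 : ℝ)) a) ≤ τ → τ ≤ 1 / 2 →
    ∀ N : (LandauFree H → E3) → ℝ, Measurable N → ∀ ν : ℝ, 0 ≤ ν → (∀ a ∈ D, |N a| ≤ ν) → ∀ x y : Site 4,
      let μD : Measure (LandauFree H → E3) := ((volume : Measure (LandauFree H → E3)).restrict D).withDensity fun a => ENNReal.ofReal (gaussWeight β H a)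
      let P : (LandauFree H → E3) → ℝ := fun a => β * ∑ p ∈ plaquettesTouching (boxEdges 4 (2 * H + 1)), tripleForm (Tc p) (plaqVar H p.1 p.2.1.1 p.2.1.2 a)
      let E : ((LandauFree H → E3) → ℝ) → ℝ := fun G => Tilt.tiltExp μD P 0 G
      let X : (LandauFree H → E3) → ℝ := chartPlaqCost H x 1 2
      let Y : (LandauFree H → E3) → ℝ := chartPlaqCost H y 1 2
      |E (fun a => (X a - E X) * (Y a - E Y) * (P a - E P) * (N a - E N)) - E (fun a => (X a - E X) * (Y a - E Y)) * E (fun a => (P a - E P) * (N a - E N))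
          - E (fun a => (X a - E X) * (P a - E P)) * E (fun a => (Y a - E Y) * (N a - E N))
          - E (fun a => (X a - E X) * (N a - E N)) * E (fun a => (Y a - E Y) * (P a - E P))| ≤
        128 * (116 * s ^ 2) ^ 2 * (Real.sqrt (Real.sqrt (729 * (CT * B ^ 2 * (H : ℝ) ^ 4 * (1 + Real.log H) ^ 3 / β) ^ 2)) * ν) := by
  obtain ⟨CT, hT⟩ := EdgeChartGaussian.tripleBond_gaussAvg_le
  refine ⟨CT, fun H hH β hβ s hs0 hs1 B Tc hTc D hDm hDs τ hτ hτ2 N mN ν hν bN x y => ?_⟩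
  have hAT := hT H hH β hβ B Tc hTc
  intro μD P E X Y
  set AT : ℝ := CT * B ^ 2 * (H : ℝ) ^ 4 * (1 + Real.log H) ^ 3 / β with hATdef
  have hAT0 : 0 ≤ AT := le_trans (EdgeChartGaussian.gaussAvg_nonneg H hβ fun a => sq_nonneg _) hAT
  set PT := plaquettesTouching (boxEdges 4 (2 * H + 1)) with hPT
  -- sup bounds on `D`
  have hXb : ∀ z : Site 4, ∀ a ∈ D, |chartPlaqCost H z 1 2 a| ≤ 116 * s ^ 2 := fun z a ha => TiltSup.abs_chartPlaqCost_le hs0 hs1 (hDs ha) z 1 2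
  have hPb : ∀ a ∈ D, |P a| ≤ β * PT.card * (6 * B * (4 * s) ^ 3) := by
    intro a ha
    show |β * ∑ p ∈ PT, tripleForm (Tc p) (plaqVar H p.1 p.2.1.1 p.2.1.2 a)| ≤ _
    rw [abs_mul, abs_of_pos hβ]
    have hterm : ∀ p ∈ PT, |tripleForm (Tc p) (plaqVar H p.1 p.2.1.1 p.2.1.2 a)| ≤ 6 * B * (4 * s) ^ 3 := by
      intro p _
      refine (EdgeChartGaussian.abs_tripleForm_le (Tc p) (hTc p) _).trans ?_
      have hB : 0 ≤ B := (abs_nonneg _).trans (hTc p 0 0 0)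
      exact mul_le_mul_of_nonneg_left (pow_le_pow_left₀ (Finset.sum_nonneg fun i _ => norm_nonneg _)
        (TiltSup.sum_norm_plaqVar_le hs0 (hDs ha) p.1 p.2.1.1 p.2.1.2) 3) (by positivity)
    have hsum : |∑ p ∈ PT, tripleForm (Tc p) (plaqVar H p.1 p.2.1.1 p.2.1.2 a)| ≤ PT.card * (6 * B * (4 * s) ^ 3) := by
      refine (Finset.abs_sum_le_sum_abs _ _).trans ((Finset.sum_le_sum hterm).trans (le_of_eq ?_))
      rw [Finset.sum_const, nsmul_eq_mul]
    calc β * |∑ p ∈ PT, tripleForm (Tc p) (plaqVar H p.1 p.2.1.1 p.2.1.2 a)| ≤ β * (PT.card * (6 * B * (4 * s) ^ 3)) :=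
        mul_le_mul_of_nonneg_left hsum hβ.le
      _ = _ := by ring
  set Bc : ℝ := max (max (116 * s ^ 2) ν) (β * PT.card * (6 * B * (4 * s) ^ 3)) with hBc
  have hBc0 : 0 ≤ Bc := le_max_of_le_left (le_max_of_le_left (by positivity))
  have bX : ∀ a ∈ D, |X a| ≤ Bc := fun a ha => (hXb x a ha).trans ((le_max_left _ _).trans (le_max_left _ _))
  have bY : ∀ a ∈ D, |Y a| ≤ Bc := fun a ha => (hXb y a ha).trans ((le_max_left _ _).trans (le_max_left _ _))
  have bN' : ∀ a ∈ D, |N a| ≤ Bc := fun a ha => (bN a ha).trans ((le_max_right _ _).trans (le_max_left _ _))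
  have bP : ∀ a ∈ D, |P a| ≤ Bc := fun a ha => (hPb a ha).trans (le_max_right _ _)
  -- measurability
  have hPc := EdgeChartGaussian.polyCert_tripleFormSum H β PT Tc hTc
  have mP : Measurable P := EdgeChartGaussian.measurable_of_polyCert hPc
  have mX : Measurable X := EdgeChartGaussian.measurable_chartPlaqCost H x 1 2
  have mY : Measurable Y := EdgeChartGaussian.measurable_chartPlaqCost H y 1 2
  -- fcl-p3's CROSS bound at `(U, V) = (P, N)` (tilt letter `P`)
  have hc := GaussRestrict.abs_cross_muSet_zero_le_gaussAvg hβ hDm hτ hτ2 hBc0 mX mY mP mN bX bY bP bN' 0 0 0 0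
  dsimp only at hc
  -- the fourth moments and the `√√` arithmetic
  have A1 := gaussAvg_indicator_mul_pow_four_le_of_bdd hβ hDm mX (hXb x)
  have A2 := gaussAvg_indicator_mul_pow_four_le_of_bdd hβ hDm mY (hXb y)
  have A3 := gaussAvg_indicator_mul_pow_four_le_of_polyCert hβ hDm hPc hAT
  have A4 := gaussAvg_indicator_mul_pow_four_le_of_bdd hβ hDm mN bN
  have n0 : ∀ F : (LandauFree H → E3) → ℝ, 0 ≤ gaussAvg β H (fun a => D.indicator (fun _ => (1 : ℝ)) a * (F a - 0) ^ 4) := fun F =>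
    EdgeChartGaussian.gaussAvg_nonneg H hβ fun a => mul_nonneg (GaussRestrict.indicator_one_nonneg_le_one D a).1 (by positivity)
  have hss := sqrt_sqrt_bound (u := (3 : ℝ) ^ (2 * 3) * AT ^ 2) (n0 _) (n0 _) (n0 _) A1 A2 A3 A4
  have hsq32 : Real.sqrt 32 * Real.sqrt 32 = 32 := Real.mul_self_sqrt (by norm_num)
  rw [sqrt_sqrt_mul_eq hν] at hss
  have hfin : 4 * ((Real.sqrt 32 * (116 * s ^ 2) ^ 2) * (Real.sqrt 32 * (Real.sqrt (Real.sqrt ((3 : ℝ) ^ (2 * 3) * AT ^ 2)) * ν))) =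
      128 * (116 * s ^ 2) ^ 2 * (Real.sqrt (Real.sqrt (729 * AT ^ 2)) * ν) := by
    have e3 : ((3 : ℝ) ^ (2 * 3) * AT ^ 2) = 729 * AT ^ 2 := by norm_num
    rw [e3]
    calc 4 * ((Real.sqrt 32 * (116 * s ^ 2) ^ 2) * (Real.sqrt 32 * (Real.sqrt (Real.sqrt (729 * AT ^ 2)) * ν)))
        = 4 * (Real.sqrt 32 * Real.sqrt 32) * (116 * s ^ 2) ^ 2 * (Real.sqrt (Real.sqrt (729 * AT ^ 2)) * ν) := by ring
      _ = _ := by rw [hsq32]; ring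
  rw [hfin] at hss
  exact hc.trans hss

/-! ## §4 The Taylor tensor of record and its quintic remainder (discharging `hR5`) -/

/-- ★ **A Taylor tensor of record for the cubic vertex** (✓7a `wilsonPlaquetteTaylor`, as in w5 g23's ✓`exists_cubicVertexPoly`): there are `C ≥ 0`, `B` and ONE
tensor family `Tc` (independent of `H`, `β`) with `|Tc p i j k| ≤ B` and, for `H ≥ 1`, `β > 0`, `0 ≤ s ≤ 1`, every `a ∈ smallField H s`:
`|cubicVertex β H a − β·Σ_{p ∈ PT} tripleForm (Tc p) (plaqVar_p a)| ≤ C·β·H⁴·s⁵` — the `ρ` of rows R3/R4 (and the `Tc, B` of R1 ✓p753305 / R2). -/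
theorem exists_tripleTensor_cubicVertex : ∃ C B : ℝ, ∃ Tc : ZdPlaquette 4 → Fin 4 → Fin 4 → Fin 4 → ℝ, 0 ≤ C ∧ (∀ p i j k, |Tc p i j k| ≤ B) ∧
    ∀ H : ℕ, 1 ≤ H → ∀ β : ℝ, 0 < β → ∀ s : ℝ, 0 ≤ s → s ≤ 1 → ∀ a ∈ smallField H s,
      |cubicVertex β H a - β * ∑ p ∈ plaquettesTouching (boxEdges 4 (2 * H + 1)), tripleForm (Tc p) (plaqVar H p.1 p.2.1.1 p.2.1.2 a)| ≤
        C * β * (H : ℝ) ^ 4 * s ^ 5 := by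
  classical
  obtain ⟨C7, h7⟩ := wilsonPlaquetteTaylor
  choose Tf hTf h7f using h7
  let T : ZdPlaquette 4 → Fin 4 → Fin 4 → Fin 4 → ℝ := fun p => Tf p.2.1.1 p.2.1.2 (ne_of_lt p.2.2)
  have hT : ∀ p i j k, |T p i j k| ≤ C7 := fun p => hTf _ _ _
  refine ⟨4096 * 1024 * (4 + 6 * C7), C7, T, ?_, hT, fun H hH β hβ s hs hs1 a ha => ?_⟩
  · have hC7 : 0 ≤ C7 := (abs_nonneg _).trans (hT (((0 : Site 4), ⟨(0, 1), by decide⟩) : ZdPlaquette 4) 0 0 0)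
    positivity
  have hV : cubicVertex β H a - β * ∑ p ∈ plaquettesTouching (boxEdges 4 (2 * H + 1)), tripleForm (T p) (plaqVar H p.1 p.2.1.1 p.2.1.2 a) =
      β * ∑ p ∈ plaquettesTouching (boxEdges 4 (2 * H + 1)),
        (chartPlaqCostOdd H p.1 p.2.1.1 p.2.1.2 a - tripleForm (T p) (plaqVar H p.1 p.2.1.1 p.2.1.2 a)) := by
    unfold cubicVertex
    rw [Finset.sum_sub_distrib, mul_sub]
  rw [hV, abs_mul, abs_of_pos hβ]
  have hR : ∀ p ∈ plaquettesTouching (boxEdges 4 (2 * H + 1)),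
      |chartPlaqCostOdd H p.1 p.2.1.1 p.2.1.2 a - tripleForm (T p) (plaqVar H p.1 p.2.1.1 p.2.1.2 a)| ≤ (4 + 6 * C7) * (4 * s) ^ 5 := by
    intro p _
    have h1 := EdgeChartGaussian.abs_odd_sub_tripleForm_le (hTf _ _ (ne_of_lt p.2.2)) H p.1 p.2.1.1 p.2.1.2
      (fun t a ht ht1 hv => (h7f _ _ (ne_of_lt p.2.2) H p.1 t a ht ht1 hv).2) a
    have hC7 : 0 ≤ C7 := (abs_nonneg _).trans (hT p 0 0 0)
    refine h1.trans (mul_le_mul_of_nonneg_left ?_ (by positivity))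
    exact pow_le_pow_left₀ (Finset.sum_nonneg fun i _ => norm_nonneg _) (TiltSup.sum_norm_plaqVar_le hs ha p.1 p.2.1.1 p.2.1.2) 5
  have hsum := (Finset.abs_sum_le_sum_abs _ _).trans (Finset.sum_le_sum hR)
  rw [Finset.sum_const, nsmul_eq_mul] at hsum
  have hcard := TiltSup.card_plaquettesTouching_le' (H := H) hH
  have hC7 : 0 ≤ C7 := (abs_nonneg _).trans (hT (((0 : Site 4), ⟨(0, 1), by decide⟩) : ZdPlaquette 4) 0 0 0)
  have hq : 0 ≤ (4 + 6 * C7) * (4 * s) ^ 5 := by positivity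
  calc β * |∑ p ∈ plaquettesTouching (boxEdges 4 (2 * H + 1)),
          (chartPlaqCostOdd H p.1 p.2.1.1 p.2.1.2 a - tripleForm (T p) (plaqVar H p.1 p.2.1.1 p.2.1.2 a))|
      ≤ β * ((plaquettesTouching (boxEdges 4 (2 * H + 1))).card * ((4 + 6 * C7) * (4 * s) ^ 5)) :=
        mul_le_mul_of_nonneg_left hsum hβ.le
    _ ≤ β * (4096 * (H : ℝ) ^ 4 * ((4 + 6 * C7) * (4 * s) ^ 5)) :=
        mul_le_mul_of_nonneg_left (mul_le_mul_of_nonneg_right hcard hq) hβ.le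
    _ = 4096 * 1024 * (4 + 6 * C7) * β * (H : ℝ) ^ 4 * s ^ 5 := by ring

end GaussNormalForm

end Summit.QuantumFields.YangMills.Theorems.AllWindowsColdBoxBoxHighLine

end
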